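import Summits.MatrixMultiplication.MatrixMultiplication.Theorems.FarEdgeDescentExactSteps
import HarnessLib

/-!
# Far-edge descent, kernel XXXVIII-A: one-step inequalities of the ANCHOR-BUDGET DIAL

Route `FarEdgeDescent`, special leaf `FiniteSaturation` (stmt-MatrixMultiplication-23739): helper
kernel, THESES-FREE and def-free (decomp-mm lens 2 «structural dichotomy: special vs generic», gen 58).

THE DIAL.  Kernel XXXVII (`FarEdgeDescentExactCeiling.exact_ceiling`) caps the exact readouts of every
product-and-full-reanchor schedule of the free-lunch toolbox at the order `θ_S = log(4/3)/log(3/2)`.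
That toolbox has ANCHOR BUDGET FACTOR `β = 2`: an anchored object `⟨1,Q,1⟩ ⊕ legs` in normal form costs
`r = Q + 2L` (`L = ΣaB` the legs' corner value; Knuth 4.6.4 Ex. 67(g): both variable sets of every kept
leg are cut from the anchor, Alman–Li 2026 Thm. 5.1 / Prop. 5.3), and a fully re-anchored product has
`Q'' = QQ' + β(β−1)LL' = QQ' + 2LL'`.  Memo NODE-g53 §2 located the summit-hard content of the leaf inside
this programme in «the factor 2»: with budget `r = Q + βL` the squaring fixed point is `λ* = 1/(2β−1)` and
the deviation multiplier `2β/(2β−1)`.  This kernel and XXXVIII-B make the dial a THEOREM at exact level for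
every schedule: in the coordinates

  `u = (2β−1)λ/3 ∈ (0, 1/3]`,  `a = 3(β−1)/(2β−1) ∈ (0, 1]`  (`β ∈ (1, 2]`),

the share dynamics is that of XXXVII VERBATIM (`u'' = u + u' − 3uu'`, `lam_step`), the normal form is
`F = 1 − a·u + X`, the cross coefficient is `c = a(3−a)` — the identity `(1−au)(1−au') + c·uu' = 1 − a·u''`
replaces `(1−u)(1−u') + 2uu' = 1 − u''` — and the exponent is

  `κ_a = log₂(2(3−a)/3) = log₂(2β/(2β−1))`,  magic identity `(1 − a/3)^{p_a} = 1/2`, `p_a = 1/(1−κ_a)`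

(`a = 1`: `κ = log₂(4/3)`, `(2/3)^p = 1/2`, kernel XXXVI-A `twoThirds_rpow_conj`).  This file: the one-step
inequalities with the parameter `a` — `chord_dial` (`(1−ax)^p ≤ 1 − 3x/2` on `[0,1/3]`), `legMass_step_dial`
(Hölder + chord: the leg-mass tax with weights `1 − au`), `product_normalForm_dial`, `deep_step_dial` (the
margin `F ≤ 1 − au/2` is hereditary once the cross factor is `≤ 1/2`), `baseFed_step_dial`,
`shallow_step_dial` (the shallow step of XXXVII-A with weights `1 − au`; unbalanced parents need
`ζ^κ ≤ aλ₀/4`).  The `a`-free lemmas of XXXVII-A (`cross_term_comparable`, `potential_absorb`,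
`rpow_comparable`, `lam_rpow_exchange`, `excess_le`) and of XXXVI-A (`holder_two`, `lam_step`) are reused
by name.  No tensors: for `β < 2` no tensor mechanism is known (memo NODE-g53 §3(e)); the dial is the
abstract recursion, and its point is the DICHOTOMY proved in XXXVIII-B/C: every `β > 1` is power-capped
(`κ_a < 1`), only `β = 1` (`a = 0`, immortal anchors, where the step is exactly multiplicative and towers are
inert) is of `FiniteSaturation` grade.

References: Schönhage 1981, §5; Pan 1984 (LNCS 179) §16 Props. 16.2–16.5; Stothers 2010, Thm. 8;
Knuth TAOCP 2 §4.6.4 Ex. 67(g),(h); Alman–Li 2026 Thm. 5.1, Prop. 5.3; Hardy–Littlewood–Pólya, Thms. 13, 37.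
Tags: `FiniteSaturation` (h₁) NEC · WEAKER · ATTACKED; support for the dial ceiling (XXXVIII-B).
-/

set_option linter.dupNamespace false

noncomputable section

namespace Summit.MatrixMultiplication.MatrixMultiplication.Theorems.FarEdgeDescentDialSteps

open Summit.MatrixMultiplication.MatrixMultiplication.Theorems.FarEdgeDescentImprovableRate
open Summit.MatrixMultiplication.MatrixMultiplication.Theorems.FarEdgeDescentAnchorTax
open Summit.MatrixMultiplication.MatrixMultiplication.Theorems.FarEdgeDescentExactSteps

/-! ## §1 The chord and the leg-mass tax with weights `1 − a·u` -/

/-- **The dial chord.**  If `p ≥ 1`, `a ≤ 3` and `(1 − a/3)^p = 1/2` then `(1 − ax)^p ≤ 1 − (3/2)x`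
for `0 ≤ x ≤ 1/3` (convexity of `y ↦ y^p` between `y = 1 − a/3` and `y = 1`; `a = 1` is kernel XXXVI-A
`chord`).  The right-hand side does not depend on `a`. [cite: HardyLittlewoodPolya1952, Thm. 37] -/
theorem chord_dial {p a : ℝ} (hp : 1 ≤ p) (ha : a ≤ 3) (hmagic : (1 - a / 3) ^ p = 1 / 2)
    {x : ℝ} (hx0 : 0 ≤ x) (hx : x ≤ 1 / 3) :
    (1 - a * x) ^ p ≤ 1 - 3 / 2 * x := by
  have hc := (convexOn_rpow hp).2 (Set.mem_Ici.2 (by linarith : (0 : ℝ) ≤ 1 - a / 3))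
    (Set.mem_Ici.2 (zero_le_one : (0 : ℝ) ≤ 1)) (by linarith : 0 ≤ 3 * x)
    (by linarith : 0 ≤ 1 - 3 * x) (by ring)
  simp only [smul_eq_mul] at hc
  have e1 : 3 * x * (1 - a / 3 : ℝ) + (1 - 3 * x) * 1 = 1 - a * x := by ring
  rw [e1, hmagic, Real.one_rpow] at hc
  linarith

/-- **The leg-mass tax on the dial — one step.**  If `m ≤ Φ(3u)^{1−κ}ℓ^κ` and `m' ≤ Φ(3u')^{1−κ}ℓ'^κ`
(`u, u' ∈ [0,1/3]`, `κ ∈ (0,1)`, `p = 1/(1−κ)`, `(1−a/3)^p = 1/2`, `a ≤ 3`), then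
`(1−au)m' + (1−au')m ≤ Φ(3u'')^{1−κ}(ℓ+ℓ')^κ`, `u'' = u + u' − 3uu'`: the potential `m/((3u)^{1−κ}ℓ^κ)` is
max-non-increasing under the dial step.  Hölder (`holder_two`) after absorbing the weights
`(1−au)c^{1−κ} = ((1−au)^p c)^{1−κ}`, and the chord `(1−au)^p u' + (1−au')^p u ≤ u''` (`chord_dial`, with
equality in the coefficients: `(1 − 3u/2)3u' + (1 − 3u'/2)3u = 3u''`).  `a = 1` is kernel XXXVI-A
`legMass_step`. [cite: Pan1984, Props. 16.4–16.5] [cite: HardyLittlewoodPolya1952, Thm. 13] -/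
theorem legMass_step_dial {κ p a Φ u v m m' ℓ ℓ' : ℝ} (hκ0 : 0 < κ) (hκ1 : κ < 1)
    (hp : p = 1 / (1 - κ)) (ha : a ≤ 3) (hmagic : (1 - a / 3) ^ p = 1 / 2) (hΦ : 0 ≤ Φ)
    (hu0 : 0 ≤ u) (hu : u ≤ 1 / 3) (hv0 : 0 ≤ v) (hv : v ≤ 1 / 3) (hℓ : 0 ≤ ℓ) (hℓ' : 0 ≤ ℓ')
    (hm : m ≤ Φ * ((3 * u) ^ (1 - κ) * ℓ ^ κ)) (hm' : m' ≤ Φ * ((3 * v) ^ (1 - κ) * ℓ' ^ κ)) :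
    (1 - a * u) * m' + (1 - a * v) * m ≤
      Φ * ((3 * (u + v - 3 * u * v)) ^ (1 - κ) * (ℓ + ℓ') ^ κ) := by
  have h1κ : 0 < 1 - κ := by linarith
  have hp1 : 1 ≤ p := by
    rw [hp, le_div_iff₀ h1κ]
    linarith
  have hpk : p * (1 - κ) = 1 := by
    rw [hp]
    field_simp
  have absorb : ∀ {w c : ℝ}, 0 ≤ w → 0 ≤ c → w * c ^ (1 - κ) = (w ^ p * c) ^ (1 - κ) := by
    intro w c hw hc
    rw [Real.mul_rpow (Real.rpow_nonneg hw p) hc, ← Real.rpow_mul hw, hpk, Real.rpow_one]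
  have hau1 : a * u ≤ 1 := by linarith [mul_nonneg (sub_nonneg.2 ha) hu0]
  have hav1 : a * v ≤ 1 := by linarith [mul_nonneg (sub_nonneg.2 ha) hv0]
  have hwu : 0 ≤ 1 - a * u := by linarith
  have hwv : 0 ≤ 1 - a * v := by linarith
  have cu := chord_dial hp1 ha hmagic hu0 hu
  have cv := chord_dial hp1 ha hmagic hv0 hv
  have hau : 0 ≤ (1 - a * u) ^ p * (3 * v) := mul_nonneg (Real.rpow_nonneg hwu p) (by linarith)
  have hbv : 0 ≤ (1 - a * v) ^ p * (3 * u) := mul_nonneg (Real.rpow_nonneg hwv p) (by linarith)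
  have t1 : (1 - a * u) * m' ≤ Φ * (((1 - a * u) ^ p * (3 * v)) ^ (1 - κ) * ℓ' ^ κ) := by
    calc (1 - a * u) * m' ≤ (1 - a * u) * (Φ * ((3 * v) ^ (1 - κ) * ℓ' ^ κ)) :=
          mul_le_mul_of_nonneg_left hm' hwu
      _ = Φ * (((1 - a * u) * (3 * v) ^ (1 - κ)) * ℓ' ^ κ) := by ring
      _ = Φ * (((1 - a * u) ^ p * (3 * v)) ^ (1 - κ) * ℓ' ^ κ) := by rw [absorb hwu (by linarith)]
  have t2 : (1 - a * v) * m ≤ Φ * (((1 - a * v) ^ p * (3 * u)) ^ (1 - κ) * ℓ ^ κ) := by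
    calc (1 - a * v) * m ≤ (1 - a * v) * (Φ * ((3 * u) ^ (1 - κ) * ℓ ^ κ)) :=
          mul_le_mul_of_nonneg_left hm hwv
      _ = Φ * (((1 - a * v) * (3 * u) ^ (1 - κ)) * ℓ ^ κ) := by ring
      _ = Φ * (((1 - a * v) ^ p * (3 * u)) ^ (1 - κ) * ℓ ^ κ) := by rw [absorb hwv (by linarith)]
  have hH := holder_two hκ0 hκ1 hau hbv hℓ' hℓ
  have hab : (1 - a * u) ^ p * (3 * v) + (1 - a * v) ^ p * (3 * u) ≤ 3 * (u + v - 3 * u * v) := by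
    linarith [mul_le_mul_of_nonneg_right cu (by linarith : (0 : ℝ) ≤ 3 * v),
      mul_le_mul_of_nonneg_right cv (by linarith : (0 : ℝ) ≤ 3 * u)]
  have hmono : ((1 - a * u) ^ p * (3 * v) + (1 - a * v) ^ p * (3 * u)) ^ (1 - κ) * (ℓ' + ℓ) ^ κ ≤
      (3 * (u + v - 3 * u * v)) ^ (1 - κ) * (ℓ + ℓ') ^ κ := by
    rw [add_comm ℓ' ℓ]
    exact mul_le_mul_of_nonneg_right (Real.rpow_le_rpow (add_nonneg hau hbv) hab h1κ.le)
      (Real.rpow_nonneg (add_nonneg hℓ hℓ') κ)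
  calc (1 - a * u) * m' + (1 - a * v) * m
      ≤ Φ * (((1 - a * u) ^ p * (3 * v)) ^ (1 - κ) * ℓ' ^ κ) +
          Φ * (((1 - a * v) ^ p * (3 * u)) ^ (1 - κ) * ℓ ^ κ) := add_le_add t1 t2
    _ = Φ * (((1 - a * u) ^ p * (3 * v)) ^ (1 - κ) * ℓ' ^ κ +
          ((1 - a * v) ^ p * (3 * u)) ^ (1 - κ) * ℓ ^ κ) := by ring
    _ ≤ Φ * (((1 - a * u) ^ p * (3 * v) + (1 - a * v) ^ p * (3 * u)) ^ (1 - κ) * (ℓ' + ℓ) ^ κ) :=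
        mul_le_mul_of_nonneg_left hH hΦ
    _ ≤ Φ * ((3 * (u + v - 3 * u * v)) ^ (1 - κ) * (ℓ + ℓ') ^ κ) :=
        mul_le_mul_of_nonneg_left hmono hΦ

/-! ## §2 One-step inequalities for the dial readout `F = 1 − a·u + X` -/

/-- **Product normal form on the dial.**  `0 ≤ F ≤ 1 − au + A`, `0 ≤ F' ≤ 1 − au' + B` and the dial step
`F'' ≤ F·F' + a(3−a)uu'·e` give `F'' ≤ 1 − au'' + (1−au')A + (1−au)B + AB − a(3−a)uu'(1−e)`,
`u'' = u+u'−3uu'` — because `(1−au)(1−au') + a(3−a)uu' = 1 − au''` identically in `a`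
(`a = 1`: XXXVII-A `product_normalForm`). [folklore] -/
theorem product_normalForm_dial {a u v A B Fa Fb Fj e : ℝ} (hFa0 : 0 ≤ Fa)
    (hFa : Fa ≤ 1 - a * u + A) (hFb0 : 0 ≤ Fb) (hFb : Fb ≤ 1 - a * v + B)
    (hFj : Fj ≤ Fa * Fb + a * (3 - a) * u * v * e) :
    Fj ≤ 1 - a * (u + v - 3 * u * v) + (1 - a * v) * A + (1 - a * u) * B + A * B -
      a * (3 - a) * u * v * (1 - e) := by
  have h : Fa * Fb ≤ (1 - a * u + A) * (1 - a * v + B) := mul_le_mul hFa hFb hFb0 (by linarith)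
  nlinarith [h]

/-- **Deep step on the dial: the margin `a/2` is hereditary.**  `0 ≤ F ≤ 1 − au/2`, `0 ≤ F' ≤ 1 − au'/2`,
`e ≤ 1/2`, `0 ≤ a ≤ 3` and `F'' ≤ FF' + a(3−a)uu'e` give `F'' ≤ 1 − au''/2`:
`(1−au/2)(1−au'/2) + a(3−a)uu'/2 = 1 − au''/2 − a²uu'/4`.  (For `a = 1` the sharp threshold is `5/8`,
XXXVII-A `deep_step`; `1/2` serves every `a` uniformly.) [folklore] -/
theorem deep_step_dial {a u v Fa Fb Fj e : ℝ} (ha0 : 0 ≤ a) (ha : a ≤ 3) (hu0 : 0 ≤ u) (hv0 : 0 ≤ v)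
    (hFa0 : 0 ≤ Fa) (hFa : Fa ≤ 1 - a * u / 2) (hFb0 : 0 ≤ Fb) (hFb : Fb ≤ 1 - a * v / 2)
    (he : e ≤ 1 / 2) (hFj : Fj ≤ Fa * Fb + a * (3 - a) * u * v * e) :
    Fj ≤ 1 - a * (u + v - 3 * u * v) / 2 := by
  have h : Fa * Fb ≤ (1 - a * u / 2) * (1 - a * v / 2) := mul_le_mul hFa hFb hFb0 (by linarith)
  have hc : 0 ≤ a * (3 - a) * u * v := by
    have : 0 ≤ a * (3 - a) := mul_nonneg ha0 (by linarith)
    positivity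
  have h2 : a * (3 - a) * u * v * e ≤ a * (3 - a) * u * v * (1 / 2) :=
    mul_le_mul_of_nonneg_left he hc
  have h3 : 0 ≤ a ^ 2 * u * v := by positivity
  nlinarith [h, h2, h3]

/-- **Base-fed step on the dial is blind.**  If one parent is a base with `F' ≤ 1 − (a(3−a)/3)u'`
and the other merely passes, `0 ≤ F ≤ 1`, `u ≤ 1/3`, then the child passes:
`F'' ≤ FF' + a(3−a)uu' ≤ 1 − a(3−a)u'(1/3 − u) ≤ 1` (`a = 1`: XXXVII-A `baseFed_step`, threshold
`1 − (2/3)λ_B`). [folklore] -/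
theorem baseFed_step_dial {a u v Fa Fb Fj : ℝ} (ha0 : 0 ≤ a) (ha : a ≤ 3) (hu : u ≤ 1 / 3)
    (hv0 : 0 ≤ v) (hFa : Fa ≤ 1) (hFb0 : 0 ≤ Fb) (hFb : Fb ≤ 1 - a * (3 - a) / 3 * v)
    (hFj : Fj ≤ Fa * Fb + a * (3 - a) * u * v) : Fj ≤ 1 := by
  have h : Fa * Fb ≤ 1 * (1 - a * (3 - a) / 3 * v) := mul_le_mul hFa hFb hFb0 (by norm_num)
  have hc : 0 ≤ a * (3 - a) := mul_nonneg ha0 (by linarith)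
  nlinarith [h, mul_nonneg (mul_nonneg hc hv0) (by linarith : (0 : ℝ) ≤ 1 / 3 - u)]

/-! ## §3 The shallow step on the dial -/

/-- **THE SHALLOW STEP ON THE DIAL** (both parents alive, `ℓ_b ≤ ℓ_a`, `ℓ_a^κ ≤ B`; `0 ≤ a ≤ 1`).  With
the potential `P(ℓ) = Φ₀ exp(γℓ^κ)`, parents obeying `0 ≤ F ≤ 1 − au + P(ℓ)σ(3u)^{1−κ}ℓ^κ` and the step
`F'' ≤ F F' + a(3−a)uu'`, the child obeys the same bound with `ℓ'' = ℓ_a + ℓ_b`,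
`u'' = u_a + u_b − 3u_au_b`.  COMPARABLE parents (`ζℓ_a ≤ ℓ_b`): the cross term costs a factor
`1 + Cσℓ_a^κ` (`cross_term_comparable`, the weights `1 − u ≤ 1 − au`), absorbed by
`ℓ''^κ ≥ (1+δ)ℓ_a^κ` (`potential_absorb`) — the linear part is `legMass_step_dial`.  UNBALANCED parents
(`ℓ_b < ζℓ_a`, `ζ^κ ≤ aλ₀/4`): the small parent's whole contribution is at most `(au_b/2)·A` and is
paid by the contraction `1 − au_b` of the big parent's excess (`lam_rpow_exchange`).  Smallness used:
`γB ≤ log 2`, `2CσB ≤ a/2`.  `a = 1` is XXXVII-A `shallow_step` (there `ζ^κ ≤ λ₀/2` suffices).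
[cite: Pan1984, Props. 16.4–16.5] [cite: Schonhage1981, §5] -/
theorem shallow_step_dial {κ p a l₀ Φ₀ C γ δ ζ σ B u v ℓa ℓb Fa Fb Fj : ℝ} (hκ0 : 0 < κ)
    (hκ1 : κ < 1) (hp : p = 1 / (1 - κ)) (ha0 : 0 ≤ a) (ha1 : a ≤ 1)
    (hmagic : (1 - a / 3) ^ p = 1 / 2) (hl₀ : 0 < l₀) (hΦ₀ : 0 ≤ Φ₀)
    (hC0 : 0 ≤ C) (hC : Φ₀ * 3 ^ (1 - κ) ≤ C * l₀ ^ κ) (hσ : 0 ≤ σ) (hγ0 : 0 ≤ γ)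
    (hγ : C * σ ≤ γ * δ) (hζ0 : 0 < ζ) (hζ : ζ ^ κ ≤ a * l₀ / 4) (hδ : 1 + δ ≤ (1 + ζ) ^ κ)
    (hγB : γ * B ≤ Real.log 2) (hCB : 2 * C * σ * B ≤ a / 2)
    (hu0 : l₀ ≤ u) (hu : u ≤ 1 / 3) (hv0 : l₀ ≤ v) (hv : v ≤ 1 / 3)
    (hℓb : 0 ≤ ℓb) (hba : ℓb ≤ ℓa) (haB : ℓa ^ κ ≤ B) (hFa0 : 0 ≤ Fa)
    (hFa : Fa ≤ 1 - a * u + Φ₀ * Real.exp (γ * ℓa ^ κ) * σ * ((3 * u) ^ (1 - κ) * ℓa ^ κ))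
    (hFb0 : 0 ≤ Fb)
    (hFb : Fb ≤ 1 - a * v + Φ₀ * Real.exp (γ * ℓb ^ κ) * σ * ((3 * v) ^ (1 - κ) * ℓb ^ κ))
    (hFj : Fj ≤ Fa * Fb + a * (3 - a) * u * v) :
    Fj ≤ 1 - a * (u + v - 3 * u * v) +
      Φ₀ * Real.exp (γ * (ℓa + ℓb) ^ κ) * σ *
        ((3 * (u + v - 3 * u * v)) ^ (1 - κ) * (ℓa + ℓb) ^ κ) := by
  have ha3 : a ≤ 3 := by linarith
  have hℓa : 0 ≤ ℓa := le_trans hℓb hba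
  have hu00 : 0 ≤ u := le_trans hl₀.le hu0
  have hv00 : 0 ≤ v := le_trans hl₀.le hv0
  have hw := lam_step hu0 hu hv00 hv
  have hw0 : 0 ≤ u + v - 3 * u * v := le_trans hl₀.le hw.1
  have hℓj : ℓa ≤ ℓa + ℓb := by linarith
  have hau0 : 0 ≤ a * u := mul_nonneg ha0 hu00
  have hav0 : 0 ≤ a * v := mul_nonneg ha0 hv00
  -- the common potential Ψ = P(ℓ_a)σ and the two excess bounds A, B'
  set Ψ : ℝ := Φ₀ * Real.exp (γ * ℓa ^ κ) * σ with hΨ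
  have hΨ0 : 0 ≤ Ψ := by positivity
  set A : ℝ := Ψ * ((3 * u) ^ (1 - κ) * ℓa ^ κ) with hA
  obtain ⟨B', hB'⟩ : ∃ B' : ℝ, B' = Ψ * ((3 * v) ^ (1 - κ) * ℓb ^ κ) := ⟨_, rfl⟩
  have hA0 : 0 ≤ A := by positivity
  have hB0 : 0 ≤ B' := by rw [hB']; positivity
  have hexp_ba : Real.exp (γ * ℓb ^ κ) ≤ Real.exp (γ * ℓa ^ κ) :=
    Real.exp_le_exp.2 (mul_le_mul_of_nonneg_left (Real.rpow_le_rpow hℓb hba hκ0.le) hγ0)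
  have hexp_aj : Real.exp (γ * ℓa ^ κ) ≤ Real.exp (γ * (ℓa + ℓb) ^ κ) :=
    Real.exp_le_exp.2 (mul_le_mul_of_nonneg_left (Real.rpow_le_rpow hℓa hℓj hκ0.le) hγ0)
  have hFb' : Fb ≤ 1 - a * v + B' := by
    have : Φ₀ * Real.exp (γ * ℓb ^ κ) * σ * ((3 * v) ^ (1 - κ) * ℓb ^ κ) ≤ B' := by
      rw [hB', hΨ]
      apply mul_le_mul_of_nonneg_right _ (by positivity)
      exact mul_le_mul_of_nonneg_right (mul_le_mul_of_nonneg_left hexp_ba hΦ₀) hσ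
    linarith
  -- A ≤ θ·u with θ = 2Cσℓ_a^κ ≤ a/2 ≤ 1/2
  have hAθ : A ≤ 2 * C * σ * ℓa ^ κ * u := excess_le hκ0 hl₀ hΦ₀ hC0 hC hσ hγ0 hℓa haB hγB hu0
  have hθ0 : 0 ≤ 2 * C * σ * ℓa ^ κ := by positivity
  have hθ : 2 * C * σ * ℓa ^ κ ≤ a / 2 :=
    le_trans (mul_le_mul_of_nonneg_left haB (by positivity)) hCB
  -- normal form (e = 1)
  have hnf : Fj ≤ 1 - a * (u + v - 3 * u * v) + (1 - a * v) * A + (1 - a * u) * B' + A * B' := by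
    have hFj1 : Fj ≤ Fa * Fb + a * (3 - a) * u * v * 1 := by rw [mul_one]; exact hFj
    have h := product_normalForm_dial hFa0 hFa hFb0 hFb' hFj1
    linarith
  -- the leg-mass tax for the potential Ψ with weights 1 − a u
  have hLM : (1 - a * u) * B' + (1 - a * v) * A ≤
      Ψ * ((3 * (u + v - 3 * u * v)) ^ (1 - κ) * (ℓa + ℓb) ^ κ) :=
    legMass_step_dial hκ0 hκ1 hp ha3 hmagic hΨ0 hu00 hu hv00 hv hℓa hℓb hA.le hB'.le
  have hR0 : 0 ≤ (3 * (u + v - 3 * u * v)) ^ (1 - κ) * (ℓa + ℓb) ^ κ :=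
    mul_nonneg (Real.rpow_nonneg (by linarith) _) (Real.rpow_nonneg (by linarith) _)
  have hΨj : Ψ ≤ Φ₀ * Real.exp (γ * (ℓa + ℓb) ^ κ) * σ := by
    rw [hΨ]; exact mul_le_mul_of_nonneg_right (mul_le_mul_of_nonneg_left hexp_aj hΦ₀) hσ
  rcases le_or_gt (ζ * ℓa) ℓb with hcomp | hsmall
  · -- CASE A: comparable parents
    have hcross := cross_term_comparable hu (show v ≤ 1 by linarith) hA0 hB0 hθ0 hAθ
    have hmonoW : (1 - v) * A + (1 - u) * B' ≤ (1 - a * v) * A + (1 - a * u) * B' := by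
      linarith [mul_nonneg (mul_nonneg (sub_nonneg.2 ha1) hv00) hA0,
        mul_nonneg (mul_nonneg (sub_nonneg.2 ha1) hu00) hB0]
    have hθ2 : (0 : ℝ) ≤ 2 * C * σ * ℓa ^ κ / 2 := by positivity
    have hcross' : A * B' ≤ 2 * C * σ * ℓa ^ κ / 2 * ((1 - a * v) * A + (1 - a * u) * B') :=
      le_trans hcross (mul_le_mul_of_nonneg_left hmonoW hθ2)
    have h1 : Fj ≤ 1 - a * (u + v - 3 * u * v) +
        (1 + 2 * C * σ * ℓa ^ κ / 2) * ((1 - a * v) * A + (1 - a * u) * B') := by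
      linarith [hnf, hcross']
    have h2 : (1 + 2 * C * σ * ℓa ^ κ / 2) * ((1 - a * v) * A + (1 - a * u) * B') ≤
        (1 + 2 * C * σ * ℓa ^ κ / 2) *
          (Ψ * ((3 * (u + v - 3 * u * v)) ^ (1 - κ) * (ℓa + ℓb) ^ κ)) :=
      mul_le_mul_of_nonneg_left (by linarith [hLM]) (by positivity)
    have hδx : (1 + δ) * ℓa ^ κ ≤ (ℓa + ℓb) ^ κ :=
      rpow_comparable hκ0.le hζ0.le hℓa hδ (by linarith)
    have h3 : (1 + C * σ * ℓa ^ κ) * Real.exp (γ * ℓa ^ κ) ≤ Real.exp (γ * (ℓa + ℓb) ^ κ) :=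
      potential_absorb hγ0 (Real.rpow_nonneg hℓa κ) hγ hδx
    have h4 : (1 + 2 * C * σ * ℓa ^ κ / 2) *
          (Ψ * ((3 * (u + v - 3 * u * v)) ^ (1 - κ) * (ℓa + ℓb) ^ κ)) ≤
        Φ₀ * Real.exp (γ * (ℓa + ℓb) ^ κ) * σ *
          ((3 * (u + v - 3 * u * v)) ^ (1 - κ) * (ℓa + ℓb) ^ κ) := by
      have e : (1 + 2 * C * σ * ℓa ^ κ / 2) *
            (Ψ * ((3 * (u + v - 3 * u * v)) ^ (1 - κ) * (ℓa + ℓb) ^ κ)) =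
          (Φ₀ * σ * ((3 * (u + v - 3 * u * v)) ^ (1 - κ) * (ℓa + ℓb) ^ κ)) *
            ((1 + C * σ * ℓa ^ κ) * Real.exp (γ * ℓa ^ κ)) := by
        rw [hΨ]; ring
      have e' : Φ₀ * Real.exp (γ * (ℓa + ℓb) ^ κ) * σ *
            ((3 * (u + v - 3 * u * v)) ^ (1 - κ) * (ℓa + ℓb) ^ κ) =
          (Φ₀ * σ * ((3 * (u + v - 3 * u * v)) ^ (1 - κ) * (ℓa + ℓb) ^ κ)) *
            Real.exp (γ * (ℓa + ℓb) ^ κ) := by ring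
      rw [e, e']
      exact mul_le_mul_of_nonneg_left h3 (mul_nonneg (mul_nonneg hΦ₀ hσ) hR0)
    linarith [h1, h2, h4]
  · -- CASE B: unbalanced parents (ℓ_b < ζℓ_a): the small parent is paid by the contraction 1 − a u_b
    have hB'le : B' ≤ a * v / 4 * A := by
      have h1 : ℓb ^ κ ≤ ζ ^ κ * ℓa ^ κ := by
        rw [← Real.mul_rpow hζ0.le hℓa]
        exact Real.rpow_le_rpow hℓb hsmall.le hκ0.le
      have h2 : ℓb ^ κ ≤ a * l₀ / 4 * ℓa ^ κ :=
        le_trans h1 (mul_le_mul_of_nonneg_right hζ (Real.rpow_nonneg hℓa κ))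
      have h3 : l₀ * (3 * v) ^ (1 - κ) ≤ v * (3 * u) ^ (1 - κ) :=
        lam_rpow_exchange hκ0 hκ1 hl₀ hu0 hv0
      have h3v : 0 ≤ (3 * v) ^ (1 - κ) := Real.rpow_nonneg (by linarith) _
      calc B' = Ψ * ((3 * v) ^ (1 - κ) * ℓb ^ κ) := hB'
        _ ≤ Ψ * ((3 * v) ^ (1 - κ) * (a * l₀ / 4 * ℓa ^ κ)) :=
            mul_le_mul_of_nonneg_left (mul_le_mul_of_nonneg_left h2 h3v) hΨ0
        _ = Ψ * ℓa ^ κ * (a / 4) * (l₀ * (3 * v) ^ (1 - κ)) := by ring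
        _ ≤ Ψ * ℓa ^ κ * (a / 4) * (v * (3 * u) ^ (1 - κ)) :=
            mul_le_mul_of_nonneg_left h3 (by positivity)
        _ = a * v / 4 * A := by rw [hA]; ring
    have hAu : A ≤ a / 2 * u := le_trans hAθ (mul_le_mul_of_nonneg_right hθ hu00)
    have hA1 : A ≤ 1 := by linarith [mul_le_mul_of_nonneg_right ha1 hu00]
    have hBv : B' ≤ a * v / 4 := by
      calc B' ≤ a * v / 4 * A := hB'le
        _ ≤ a * v / 4 * 1 := mul_le_mul_of_nonneg_left hA1 (by positivity)
        _ = a * v / 4 := mul_one _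
    have hcrossB : A * B' ≤ A * (a * v / 4) := mul_le_mul_of_nonneg_left hBv hA0
    have huB : (1 - a * u) * B' ≤ B' := by linarith [mul_nonneg hau0 hB0]
    have h5 : Fj ≤ 1 - a * (u + v - 3 * u * v) + A := by
      linarith [hnf, hcrossB, hB'le, huB, mul_nonneg hav0 hA0]
    have hmono1 : (3 * u) ^ (1 - κ) ≤ (3 * (u + v - 3 * u * v)) ^ (1 - κ) :=
      Real.rpow_le_rpow (by linarith)
        (by linarith [mul_nonneg hv00 (by linarith : (0 : ℝ) ≤ 1 - 3 * u)]) (by linarith)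
    have hmono2 : ℓa ^ κ ≤ (ℓa + ℓb) ^ κ := Real.rpow_le_rpow hℓa hℓj hκ0.le
    have h6 : A ≤ Φ₀ * Real.exp (γ * (ℓa + ℓb) ^ κ) * σ *
        ((3 * (u + v - 3 * u * v)) ^ (1 - κ) * (ℓa + ℓb) ^ κ) := by
      rw [hA]
      exact mul_le_mul hΨj (mul_le_mul hmono1 hmono2 (Real.rpow_nonneg hℓa κ)
        (Real.rpow_nonneg (by linarith) _)) (by positivity) (le_trans hΨ0 hΨj)
    linarith [h5, h6]

end Summit.MatrixMultiplication.MatrixMultiplication.Theorems.FarEdgeDescentDialSteps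

end
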